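import Mathlib
import Summits.NavierStokesRegularity.NavierStokesRegularity.Theses.QuarterLogPincer
import HarnessLib

/-!
# `QuarterLogPincer.SuperlogCubeRateGlue` — the glue of the gen-1 split of `SuperlogCubeRate`
# (item stmt-NavierStokesRegularity-24079; pure logic)

**Statement.** `TypeIQuantSubcubicExp → CubeBridge → SuperlogCubeRate`, where
`CubeBridge := TypeIQuantSubcubicExp → SuperlogCubeRate`: modus ponens.

The analytic content of the split is `CubeBridge` (item stmt-NavierStokesRegularity-24078, the
provable cube bridge via the Leray-rate rung); the open child is `TypeIQuantSubcubicExp`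
(stmt-NavierStokesRegularity-24077, the `o_M(A³)` quantitative ESS at the Barker–Prange boundary).
HONEST FRAMING: pure logic between the route's own statements; nothing about Navier–Stokes
regularity is proved here.
-/

noncomputable section

set_option linter.dupNamespace false

namespace Summit.NavierStokesRegularity.NavierStokesRegularity.Theorems

/-- **Item stmt-NavierStokesRegularity-24079** (`QuarterLogPincer.SuperlogCubeRateGlue`):
`TypeIQuantSubcubicExp → CubeBridge → SuperlogCubeRate` is modus ponens (`CubeBridge` unfolds to
`TypeIQuantSubcubicExp → SuperlogCubeRate`). [this file] -/
theorem quarterLogPincer_superlogCubeRateGlue_proof :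
    Summit.NavierStokesRegularity.NavierStokesRegularity.Theses.QuarterLogPincer.SuperlogCubeRateGlue := by
  unfold Summit.NavierStokesRegularity.NavierStokesRegularity.Theses.QuarterLogPincer.SuperlogCubeRateGlue
    Summit.NavierStokesRegularity.NavierStokesRegularity.Theses.QuarterLogPincer.CubeBridge
  intro h₁ h₂
  exact h₂ h₁

end Summit.NavierStokesRegularity.NavierStokesRegularity.Theorems

end
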